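import Summits.AtomisticToContinuum.HydrodynamicLimit.Theses.ImplosionDichotomy
import Summits.AtomisticToContinuum.HydrodynamicLimit.Theorems.DenseExcursion.Negative.Dichotomy

/-!
# `DiluteOfNotPolynomialCompression` (route `ImplosionDichotomy`, stmt-AtomisticToContinuum-14731)

The negative-side edge of the ladder: refuting the rank-4 crux `PolynomialCompression` PROVES the
`closes` hypothesis `DiluteSelfConsistency`.

Proof: the ladder `κ = 2` (`not_denseExcursion_and_not_polynomialCompression`: a dense excursion —
packing `η` at some `σ ≤ η` — is a density `≥ σ⁻²`, so `DenseExcursion → PolynomialCompression`),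
contraposed, gives `¬ PolynomialCompression → ¬ DenseExcursion`; the dichotomy
`not_denseExcursion_iff_diluteSelfConsistency` (`¬ DenseExcursion ↔ DiluteSelfConsistency`, the `t = 0`
tie being flow-independent and flow families existing for `σ < 1/2` by Alexander's theorem) finishes.
Both ingredients are landed in `Theorems/DenseExcursion/Negative/Dichotomy.lean`.
-/

namespace Summit.AtomisticToContinuum.HydrodynamicLimit.Theorems

open Summit.AtomisticToContinuum.HydrodynamicLimit.Theses.ImplosionDichotomy

/-- **stmt-AtomisticToContinuum-14731** (`DiluteOfNotPolynomialCompression`):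
`¬ PolynomialCompression → DiluteSelfConsistency` — no polynomial compression ⇒ no dense excursion
(ladder `κ = 2`) ⇒ dilute self-consistency (dichotomy). [folklore] -/
theorem diluteOfNotPolynomialCompression_proof : DiluteOfNotPolynomialCompression := by
  unfold DiluteOfNotPolynomialCompression
  intro hPC
  exact not_denseExcursion_iff_diluteSelfConsistency.mp
    (fun hDE => not_denseExcursion_and_not_polynomialCompression ⟨hDE, hPC⟩)

end Summit.AtomisticToContinuum.HydrodynamicLimit.Theorems
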